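import Summits.MatrixMultiplication.MatrixMultiplication.Theorems.AbelianSTPPCensusTECertKnapsack
import Summits.MatrixMultiplication.MatrixMultiplication.Theorems.AbelianSTPPCensusTAGainTable2371Ext4

/-!
# T_A/1700 certificate: the linear one-pass checker of T_A/1200 at the universe `1700`, orders `1201 … 1700` (definitions)

Cell mm-stpp (rung F-M1).  VERBATIM `AbelianSTPPCensusTALin1200Defs.lean` (seat theory g10, p507150; design, the Grynkiewicz budget of the
maximal member and the two linear bounds are described there) with: universe `Mtop = 1700`, `Tmax = 150` (`a·b ≤ 1700^{2/3} < 143` for sorted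
candidates), gains `ShapeCert.gainOf2371w` (table to `V ≤ 1700`, `AbelianSTPPCensusTAGainTable2371Ext4.lean`), order range `lo = 1201`,
`n = 500` in the segment theorems; the checkpoint states (63 segments of ≤ 150 sorted candidate shapes, every segment re-derived in the kernel)
are in `…TALin1700Data1/2/3.lean`.  Seat model HOME/mm-stpp-theory/ta1700/gen_talin1700.py: all (shape, order) checks pass at `Mtop = 1700`
(kit j273228: the all-linear relaxation passes every order `1201 … 1700`, worst margin `3.6·10⁶` at `(1699, (2,3,96))`; it first fails ≈ `1750`).
Orders `≤ 1200`: `noAbelianSTPPHostUpTo_2371_1200` (p513184).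
WHAT THIS IS NOT: no statement about STPP families or `ω` — arithmetic on shape lists only; nothing about orders `> 1700`.
-/

set_option linter.dupNamespace false
set_option autoImplicit false

namespace Summit.MatrixMultiplication.MatrixMultiplication.Theorems.TALin1700

open TECert (tableOK vol us)
open ShapeCert (gainOf2371w D)

/-! ## The checker -/

/-- Largest order of the certificate (universe of candidate shapes: the single-member table at order `1200`). -/
def Mtop : ℕ := 1700

/-- Largest `t = a·b` (two smaller sizes of a sorted candidate shape) for which a U11-G density is maintained (`a·b ≤ V^{2/3} < 113` for
`V ≤ 1200`). -/
def Tmax : ℕ := 150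

/-- The candidate shapes of volume exactly `V` (all orientations): `(a, b, c)` with `abc = V` passing `TECert.tableOK` at order `Mtop`
(verbatim `TAKnap.triples` / `TAKnap575.triples` at this file's `Mtop`). -/
def triples (V : ℕ) : List (ℕ × ℕ × ℕ) :=
  (List.range V).flatMap fun a' =>
    if V % (a' + 1) = 0 then
      (List.range (V / (a' + 1))).filterMap fun b' =>
        if V / (a' + 1) % (b' + 1) = 0 ∧ tableOK Mtop (a' + 1) (b' + 1) (V / (a' + 1) / (b' + 1)) = true then
          some (a' + 1, b' + 1, V / (a' + 1) / (b' + 1))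
        else none
    else []

/-- Minimum of `f` over a list of shapes, below the default `m₀` (`min x y` written branch-free as `x − (x − y)`; as `TAKnap.minOver`). -/
def minOver (f : ℕ × ℕ × ℕ → ℕ) (m₀ : ℕ) (ts : List (ℕ × ℕ × ℕ)) : ℕ :=
  ts.foldr (fun t m => f t - (f t - m)) m₀

/-- `pmin`: the least `ab+bc+ca` over the candidate shapes `ts` of a volume (default `3·Mtop` for no shapes). -/
def pminL (ts : List (ℕ × ℕ × ℕ)) : ℕ := minOver us (3 * Mtop) ts

/-- sorted shapes `a ≤ b ≤ c` (the checks run on these; a member's sorted form is a candidate with the same invariants). -/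
def srt (x : ℕ × ℕ × ℕ) : Bool := Nat.ble x.1 x.2.1 && Nat.ble x.2.1 x.2.2

/-- Checker state: `(gP, pP, W)` — `gP/pP` = the largest `g(V′)/pmin(V′)` over the volumes met so far (vM density); `W[t] = (gW, wW, ok)` = the
largest `g(V′)/(t·pmin(V′) − V′)` over the volumes met so far, `ok = false` once some met volume has `t·pmin(V′) ≤ V′` (U11-G density at `t`). -/
abbrev St : Type := ℕ × ℕ × List (ℕ × ℕ × Bool)

/-- Initial state: densities `0/1`, all `t` valid. -/
def st0 : St := (0, 1, List.replicate (Tmax + 1) (0, 1, true))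

/-- Update of one U11-G density entry at index `t` by the volume `V` (gain `g`, least pair-product sum `pm`). -/
def updWe (V g pm t : ℕ) (e : ℕ × ℕ × Bool) : ℕ × ℕ × Bool :=
  if e.2.2 then
    (if t * pm ≤ V then (e.1, e.2.1, false)
     else if e.1 * (t * pm - V) < g * e.2.1 then (g, t * pm - V, true) else (e.1, e.2.1, true))
  else e

/-- Update of the whole state by the volume `V` (gain `g`, least pair-product sum `pm`). -/
def upd (V g pm : ℕ) (s : St) : St :=
  ((if s.1 * pm < g * s.2.1 then g else s.1), (if s.1 * pm < g * s.2.1 then pm else s.2.1),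
    s.2.2.mapIdx fun t e => updWe V g pm t e)

/-- vM budget of the non-maximal members (units `ab+bc+ca`): `min(⌊(3M − d)/2⌋, 3(M − V))` (verbatim `TAKnap.cap`). -/
def cap (M V d : ℕ) : ℕ :=
  let x := (3 * M - d) / 2
  x - (x - 3 * (M - V))

/-- vM check at order `M` for a maximal member of volume `V`, gain `g`, excess `d`: `g·pP + cap·gP ≤ 10⁶·M·pP`. -/
def passVM (M V g d : ℕ) (s : St) : Bool :=
  Nat.ble (g * s.2.1 + cap M V d * s.1) (D * M * s.2.1)

/-- vP (U11-G) check at order `M` for a maximal member of volume `V`, gain `g`, pair-product sum `p`, `t` = product of its two smaller sizes,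
against the density entry `e = (gW, wW, ok)`: `t ≥ 3`, valid, `V ≤ t·p`, and `g·wW + bud·gW ≤ 10⁶·M·wW` with `bud = (t·M + 2t² − 1) − (t·p − V)`
(truncated). -/
def passVP (M V g p t : ℕ) (e : ℕ × ℕ × Bool) : Bool :=
  Nat.ble 3 t && e.2.2 && Nat.ble V (t * p) &&
    Nat.ble (g * e.2.1 + ((t * M + 2 * t * t - 1) - (t * p - V)) * e.1) (D * M * e.2.1)

/-- The check of one candidate shape `x` at order `M` in state `s` (unsorted shapes are skipped: `true`). -/
def checkShape (s : St) (M : ℕ) (x : ℕ × ℕ × ℕ) : Bool :=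
  !(srt x) ||
    (passVP M (vol x) (gainOf2371w (vol x)) (us x) (x.1 * x.2.1) (s.2.2.getD (x.1 * x.2.1) (0, 1, false)) ||
      passVM M (vol x) (gainOf2371w (vol x)) (2 * us x - (x.1 + x.2.1 + x.2.2)) s)

/-- All shapes `ts` pass at the `n` orders `M, M+1, …, M+n−1`. -/
def checkAll (s : St) (ts : List (ℕ × ℕ × ℕ)) : ℕ → ℕ → Bool
  | 0, _ => true
  | n + 1, M => ts.all (checkShape s M) && checkAll s ts n (M + 1)

/-- Sum of the state's numbers (semantically irrelevant: evaluating it makes the kernel normalise each new state before the next volume). -/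
def stSum (s : St) : ℕ := s.1 + s.2.1 + s.2.2.foldl (fun acc e => acc + e.1 + e.2.1) 0

/-- The main loop over the volumes `V, V+1, …, V+k−1` (fuel `k`) for the orders `lo … lo+n−1`: fold the volume into the state (nothing if no
candidate shape has volume `V`), check every candidate shape of volume `V` at every order against the NEW state, continue; returns the conjunction
of the checks and the final state. -/
def loopL (lo n : ℕ) : ℕ → ℕ → St → Bool × St
  | 0, _, s => (true, s)
  | k + 1, V, s =>
    let ts := triples V
    match ts with
    | [] => loopL lo n k (V + 1) s
    | _ :: _ =>
      let s' := upd V (gainOf2371w V) (pminL ts) s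
      let r := loopL lo n k (V + 1) s'
      ((Nat.beq (stSum s') (stSum s') && checkAll s' ts n lo) && r.1, r.2)

/-! ## Checkpoint states: in `…TALin1700Data1/2/3.lean` (data; certified by the segment evaluations, not trusted) -/

/-! ## Specification vocabulary of the soundness proof (checker-internal predicates, no claims) -/

/-- Candidate shapes: sizes `≥ 1` and the single-member table at order `Mtop` (checker-internal predicate, no claim). [bookkeeping] -/
def Cand (x : ℕ × ℕ × ℕ) : Prop := 1 ≤ x.1 ∧ 1 ≤ x.2.1 ∧ 1 ≤ x.2.2 ∧ tableOK Mtop x.1 x.2.1 x.2.2 = true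

/-- The state invariant at volume `V`: the vM density dominates every candidate shape of volume `≤ V` (`g(vol x)·pP ≤ gP·us x`, `pP ≥ 1`), and for
each `t ≤ Tmax` whose entry is valid, `t·us x > vol x` and `g(vol x)·wW ≤ gW·(t·us x − vol x)` for every candidate shape of volume `≤ V`
(`wW ≥ 1`); the entry list has length `Tmax + 1` (checker-internal predicate, no claim). [bookkeeping] -/
def Inv (V : ℕ) (s : St) : Prop :=
  1 ≤ s.2.1 ∧ (∀ x, Cand x → vol x ≤ V → gainOf2371w (vol x) * s.2.1 ≤ s.1 * us x) ∧
  s.2.2.length = Tmax + 1 ∧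
  ∀ t, t ≤ Tmax → (s.2.2.getD t (0, 1, false)).2.2 = true →
    1 ≤ (s.2.2.getD t (0, 1, false)).2.1 ∧
    ∀ x, Cand x → vol x ≤ V → vol x < t * us x ∧
      gainOf2371w (vol x) * (s.2.2.getD t (0, 1, false)).2.1 ≤ (s.2.2.getD t (0, 1, false)).1 * (t * us x - vol x)

/-- Volume `V` is checked for the orders `lo … lo+n−1`: if some candidate shape has volume `V`, a state satisfying the invariant at `V` passes
`checkShape` for every candidate shape of volume `V` at every order of the range (the conclusion of the segment evaluations, consumed by
`…TALin1700Sound.lean`; no claim by itself). [bookkeeping] -/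
def Checked (lo n V : ℕ) : Prop :=
  triples V ≠ [] → ∃ s : St, Inv V s ∧ ∀ M, lo ≤ M → M < lo + n → ∀ x ∈ triples V, checkShape s M x = true

end Summit.MatrixMultiplication.MatrixMultiplication.Theorems.TALin1700
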